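import Summits.BirchSwinnertonDyer.BirchSwinnertonDyer.Theorems.ManinLocalTwoThreeTwoShiftEqualiserHolds
import Summits.BirchSwinnertonDyer.Rank1Residual.ManinAdditive.PrimeShiftEqualiserLaw
import HarnessLib

/-!
# The 2-ADIC TWIN, VIII: the prime-generic shift-equaliser law AT THE PRIME 2 holds — `ShiftEqualiser.PrimeShiftInvariantIsDiamondAtPrime 2`
# BY NAME (every level `N`, including the degenerate `N = 0`)
# (route `ManinLocalTwoThree`, cell bsd-f2-manin; crux C2 `ManinOddAtFour` stmt-BirchSwinnertonDyer-22967; prover seat p3 gen 11)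

The typer's prime-generic law `ShiftEqualiser.PrimeShiftInvariantIsDiamond` (`…/ManinAdditive/PrimeShiftEqualiserLaw.lean`, p688737; LEAD
p1 census) is the conjunction over primes `p` of `PrimeShiftInvariantIsDiamondAtPrime p := ∀ N, ShiftInvariantIsDiamondAt (ZMod p) p N`.
Its `p = 2` instance is G₂ `TwoShift.twoShiftInvariantIsDiamond_holds` (file VI, every `N ≥ 1`) plus the degenerate level `N = 0`
(`Γ₀(0)` = upper triangular matrices; port of the seat's `nineShiftInvariantIsDiamond_zero`: `φ(1 b; 0 1) = φ(1 2b; 0 1) = 2φ(1 b; 0 1)`,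
so `φ(1 b; 0 1) = 0` in `𝔽₂`).  Hence **`primeShiftInvariantIsDiamondAtPrime_two : ShiftEqualiser.PrimeShiftInvariantIsDiamondAtPrime 2`**
(the two dialects agree definitionally up to `((2 : ℕ) : ℤ) = 2`, bridged by `g0Of_congr`).  With es/p1's `p = 3` instance the open part of
the prime-generic law is exactly `p ≥ 5`, `p ∣ N`.  Nothing about BSD, Manin's conjecture or C2 is proved by this.
[cite: DarmonDiamondTaylor1995, Lemma 4.28 (p. 135) (shape: degeneracy maps on `Γ₀`)]
-/

set_option autoImplicit false
set_option linter.dupNamespace false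

open scoped MatrixGroups

open CongruenceSubgroup Matrix.SpecialLinearGroup
open Summit.BirchSwinnertonDyer.Rank1Residual.ManinAdditive.NineShiftEqualiser (slOf g0Of slOf_apply_00 slOf_apply_01
  slOf_apply_10 slOf_apply_11 slOf_mem_gamma0 g0Of_congr)
open Summit.BirchSwinnertonDyer.Rank1Residual.ManinAdditive (ShiftEqualiser.IsShiftInvariant ShiftEqualiser.ShiftInvariantIsDiamondAt
  ShiftEqualiser.PrimeShiftInvariantIsDiamondAtPrime)

namespace Summit.BirchSwinnertonDyer.BirchSwinnertonDyer.Theorems.ManinLocalTwoThree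

namespace TwoShift

/-! ### §1. The degenerate level `N = 0` -/

/-- **G₂ at the degenerate level `N = 0`** (`Γ₀(0)` = upper triangular matrices): an additive 2-shift-invariant `φ : Γ₀(0) → 𝔽₂` is a
diamond class, since every `γ ∈ Γ₁(0)` is `(1 b; 0 1)` and `φ(1 b; 0 1) = φ(1 2b; 0 1) = 2·φ(1 b; 0 1) = 0`. [folklore] -/
theorem twoShiftInvariantIsDiamondAt_zero : TwoShiftInvariantIsDiamondAt 0 := by
  intro φ hadd h2 γ hγ
  obtain ⟨h00, h11, h10⟩ := (Gamma1_mem 0 γ).mp hγ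
  have e00 : (γ 0 0 : ℤ) = 1 := by
    have := (ZMod.intCast_eq_intCast_iff' (γ 0 0 : ℤ) 1 0).mp (by exact_mod_cast h00)
    simpa using this
  have e11 : (γ 1 1 : ℤ) = 1 := by
    have := (ZMod.intCast_eq_intCast_iff' (γ 1 1 : ℤ) 1 0).mp (by exact_mod_cast h11)
    simpa using this
  have e10 : (γ 1 0 : ℤ) = 0 := by
    have := (ZMod.intCast_zmod_eq_zero_iff_dvd (γ 1 0 : ℤ) 0).mp (by exact_mod_cast h10)
    simpa using this
  set δ : Gamma0 0 := ⟨γ, Gamma1_in_Gamma0 0 hγ⟩ with hδ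
  have hdet := gamma0_det_entries δ
  have hdvd : ((0 : ℕ) : ℤ) ∣ (δ : SL(2, ℤ)) 1 0 := (ZMod.intCast_zmod_eq_zero_iff_dvd _ 0).mp (Gamma0_mem.mp δ.2)
  have eδ : δ = g0Of (M := 0) 1 ((γ 0 1 : ℤ)) 0 1 (by ring) (dvd_refl _) := by
    rw [← g0Of_entries δ hdet hdvd]
    exact g0Of_congr e00 rfl e10 e11 _ _ _ _
  rw [eδ]
  have key := h2 1 ((γ 0 1 : ℤ)) 0 1 (by ring) (dvd_refl _)
  have e₁ : g0Of (M := 0) 1 ((γ 0 1 : ℤ)) (2 * 0) 1 (by ring) (Dvd.dvd.mul_left (dvd_refl _) 2) =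
      g0Of 1 ((γ 0 1 : ℤ)) 0 1 (by ring) (dvd_refl _) := g0Of_congr rfl rfl (by ring) rfl _ _ _ _
  have e₂ : g0Of (M := 0) 1 (2 * (γ 0 1 : ℤ)) 0 1 (by ring) (dvd_refl _) =
      (g0Of (M := 0) 1 ((γ 0 1 : ℤ)) 0 1 (by ring) (dvd_refl _)) ^ 2 := by
    rw [g0Of_unipotent_pow]; rfl
  rw [e₁, e₂, hadd.map_pow] at key
  rw [← key, show ((2 : ℕ) : ZMod 2) = 0 from rfl, zero_mul]

/-- **G₂ at EVERY level `N`** (including `N = 0`). [new: cell bsd-f2-manin, p3 g11 + p1 g12 + p2 g12] -/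
theorem twoShiftInvariantIsDiamondAt_all (N : ℕ) : TwoShiftInvariantIsDiamondAt N := by
  rcases Nat.eq_zero_or_pos N with rfl | hN
  · exact twoShiftInvariantIsDiamondAt_zero
  · exact twoShiftInvariantIsDiamond_holds N hN

/-! ### §2. The prime-generic law at `p = 2`, by name -/

/-- **`ShiftEqualiser.PrimeShiftInvariantIsDiamondAtPrime 2` HOLDS**: for every level `N`, every additive `φ : Γ₀(N) → ℤ/2` invariant
under the `2`-shift is a diamond class — the `p = 2` instance of the LEAD's prime-generic equaliser law, BY NAME in the typer's dialect.
[new: cell bsd-f2-manin, p3 g11 + p1 g12 + p2 g12] -/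
theorem primeShiftInvariantIsDiamondAtPrime_two : ShiftEqualiser.PrimeShiftInvariantIsDiamondAtPrime 2 := by
  intro N φ hadd hinv
  refine twoShiftInvariantIsDiamondAt_all N φ hadd ?_
  intro a b c d hdet hc
  have h := hinv a b c d (by push_cast; linear_combination hdet) hc
  exact (congrArg φ (g0Of_congr rfl (by push_cast; ring) rfl rfl _ _ _ _)).trans
    (h.trans (congrArg φ (g0Of_congr rfl rfl (by push_cast; ring) rfl _ _ _ _)))

end TwoShift

end Summit.BirchSwinnertonDyer.BirchSwinnertonDyer.Theorems.ManinLocalTwoThree
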